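import Mathlib
import HarnessLib
import Summits.Ventures.LatticeQCDFlow.Exactness.SUNResidualLayerJacobianDet
import Summits.Ventures.LatticeQCDFlow.Exactness.SUNStoutLatticeLayer

/-!
# The masked `SU(N)` STOUT layer's exact Jacobian is the closed-form product of one-link determinants, for every `N`

HONEST FRAMING: exact (Metropolis-corrected) sampling algorithms for lattice gauge theory;
figures of merit are autocorrelation/cost numbers at stated couplings and volumes; no
continuum-physics claim.

Venture `LatticeQCDFlow` (cell pub-lqcd), topic `Exactness`; FANOUT row 10 (`eng-equiv`: `equiv/residual.py`,
`flows_jax/residual_flow.py`, `flows_jax/layers.py::sun_stout` — the stout layer and its closed-form log-det).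
NEW WORK of the cell; no definition (local notations only); nothing cited as a fact.  File 9 of the series "the
residual layer's exact Jacobian IS the closed form" (`SUNJacobianTraceAlgebra` … `SUNResidualLayerJacobianDet`).

* **`hasJacobian_sunStoutLatticeLayer_det`** — under EXACTLY the hypotheses of gen-11's `hasJacobian_sunStoutLatticeLayer`
  (mask `p` with frozen staples `h1`–`h6`, coefficient `ρ V e = R e (V|frozen)` with `2(d−1)|R| < 1`, realised
  ambiently by `C²` functions `Ramb e`): (i) `0 < ∏_{a active} det TopS[1, U, a]`; (ii)
  `HasJacobian (⊗_e Haar_{SU(n)}) (V e ↦ e^{ρ_e 𝒫(Ω_e(V))} V e on active links) (ofReal ∘ ∏_{a active} det TopS[1, U, a])`,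
  where `TopS[1, U, a]` is the right-trivialised derivative of the stout link update at the active link `a` (local
  notation = `Top` of `SUNResidualTangentOperator` for the stout exponent `ρ 𝒫(Ω)`), every `n`, `d`, `L ≥ 1`;
* `hasJacobian_sunStoutLatticeLayer_const_det` — the classic stout step with one constant parameter `r`,
  `2(d−1)|r| < 1`.
Both are one-line specialisations of `hasJacobian_sunResidualLayer_det` through the reduction of
`SUNStoutLatticeLayer.sunStoutLayer_eq_coupleFun` (as in gen-11 file `SUNStoutLayerJacobian`).

Printed counterparts, NAMED ONLY: Morningstar–Peardon, PRD 69 (2004) 054501 (stout links); Lüscher, CMP 293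
(2010) 899, §3; Abbott et al., arXiv:2305.02402 §4.2.
-/

noncomputable section

namespace Summit.Ventures.LatticeQCDFlow.Exactness

open Literature.MathematicalPhysics.QuantumFieldTheory
open Literature.MathematicalPhysics.QuantumFieldTheory.Luscher2010
open Literature.MathematicalPhysics.QuantumFieldTheory.WilsonFlow
open MeasureTheory Filter Set
open scoped Matrix Matrix.Norms.Frobenius Topology ContDiff ENNReal

variable {d L n : ℕ} [NeZero L]

section Stout

variable (p : Edge d L → Prop) [DecidablePred p] (Ramb : Edge d L → AmbConfig d L n → ℝ)

set_option quotPrecheck false in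
/-- The STOUT isotopy at time `τ` on ambient configurations (local notation): active links are moved by
`e^{τ ρ 𝒫(Ω_e(W))}`, the coefficient `ρ = Ramb e` read (ambiently) from the frozen links. -/
local notation "fambS[" τ "]" => (fun (W : AmbConfig d L n) (e : Edge d L) =>
  if h : p e then NormedSpace.exp ((τ : ℝ) • ((Ramb e W : ℂ) • suProj (loopSumAmb W e.1 e.2))) * W e else W e)

set_option quotPrecheck false in
/-- The block of the stout tangential operator (local notation; `Blk` of `SUNResidualTangentOperator` for the
stout exponent). -/
local notation "BlkS[" τ ", " W ", " a "]" =>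
  ((fderiv ℝ (fun Y : Matrix (Fin n) (Fin n) ℂ => Y * ((fambS[τ]) W a)ᴴ) 0).comp
    ((fderiv ℝ (fun W' : AmbConfig d L n => W' a) 0).comp
      ((fderiv ℝ (fambS[τ]) W).comp
        ((fderiv ℝ (fun Y : Matrix (Fin n) (Fin n) ℂ => (Pi.single a Y : AmbConfig d L n)) 0).comp
          (fderiv ℝ (fun Y : Matrix (Fin n) (Fin n) ℂ => Y * W a) 0)))))

set_option quotPrecheck false in
/-- The stout tangential operator (local notation; `Top` of `SUNResidualTangentOperator` for the stout
exponent): `𝒫 ∘ BlkS ∘ 𝒫 + (1 − 𝒫)`. -/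
local notation "TopS[" τ ", " W ", " a "]" =>
  ((fderiv ℝ (suProj (n := n)) 0).comp ((BlkS[τ, W, a]).comp (fderiv ℝ (suProj (n := n)) 0)) +
    (ContinuousLinearMap.id ℝ (Matrix (Fin n) (Fin n) ℂ) - fderiv ℝ (suProj (n := n)) 0))

/-- **The masked `SU(N)` STOUT layer has the closed-form Jacobian `∏_{a active} det TopS[1, U, a]`** (every
`n`, `d`, `L ≥ 1`).  Hypotheses exactly those of `hasJacobian_sunStoutLatticeLayer` (gen 11): a mask `p` whose
active links have all their staples frozen (`h1`–`h6`), a coefficient `ρ V e = R e (V|frozen)` on active links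
with `2(d−1)|R| < 1`, realised ambiently by `C²` functions `Ramb e`.  Conclusion: (o) continuity and (i) positivity of the product of the one-link
determinants `det TopS[1, U, a]` — `TopS[1, U, a] X = 𝒫((∂_{single a (𝒫X U_a)} (e^{ρ𝒫(Ω_a)} U_a)) (e^{ρ𝒫(Ω_a)} U_a)ᴴ) + (X − 𝒫X)`,
the right-trivialised derivative of the stout link update at the active link `a` — is everywhere positive, and
(ii) it IS the exact Jacobian of the stout layer for product Haar:
`HasJacobian (⊗_e Haar_{SU(n)}) (V e ↦ e^{ρ_e 𝒫(Ω_e(V))} V e on active e) (ofReal ∘ ∏_{a active} det TopS[1, U, a])` —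
the log-det the engine books for `SUNStoutLayer` / `flows_jax.residual_flow`. -/
theorem hasJacobian_sunStoutLatticeLayer_det
    (ρ : GaugeConfig d L (Matrix.specialUnitaryGroup (Fin n) ℂ) → Edge d L → ℝ)
    (R : (e : Edge d L) → ({f : Edge d L // ¬p f} → Matrix.specialUnitaryGroup (Fin n) ℂ) → ℝ)
    (hR : ∀ V e, p e → ρ V e = R e (fun f => V f))
    (h1 : ∀ e, p e → ∀ ν, ν ≠ e.2 → ¬p (e.1.shift e.2, ν))
    (h2 : ∀ e, p e → ∀ ν, ν ≠ e.2 → ¬p (e.1.shift ν, e.2))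
    (h3 : ∀ e, p e → ∀ ν, ν ≠ e.2 → ¬p (e.1, ν))
    (h4 : ∀ e, p e → ∀ ν, ν ≠ e.2 → ¬p ((e.1 - Pi.single ν 1).shift e.2, ν))
    (h5 : ∀ e, p e → ∀ ν, ν ≠ e.2 → ¬p (e.1 - Pi.single ν 1, e.2))
    (h6 : ∀ e, p e → ∀ ν, ν ≠ e.2 → ¬p (e.1 - Pi.single ν 1, ν))
    (hκ : ∀ e y, p e → 2 * (d - 1 : ℝ) * |R e y| < 1)
    (hRamb2 : ∀ e, ContDiff ℝ 2 (Ramb e))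
    (hRambR : ∀ (V : GaugeConfig d L (Matrix.specialUnitaryGroup (Fin n) ℂ)) e, p e →
      Ramb e (coeConfig V) = R e (fun f => V f)) :
    Continuous (fun U : GaugeConfig d L (Matrix.specialUnitaryGroup (Fin n) ℂ) =>
      ∏ a : {e : Edge d L // p e}, (TopS[(1 : ℝ), coeConfig U, a.1]).det) ∧
    (∀ U : GaugeConfig d L (Matrix.specialUnitaryGroup (Fin n) ℂ),
      0 < ∏ a : {e : Edge d L // p e}, (TopS[(1 : ℝ), coeConfig U, a.1]).det) ∧
    HasJacobian (Measure.pi fun _ : Edge d L => haarProbability (Matrix.specialUnitaryGroup (Fin n) ℂ))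
      (fun (V : GaugeConfig d L (Matrix.specialUnitaryGroup (Fin n) ℂ)) (e : Edge d L) =>
        if p e then
          (⟨NormedSpace.exp ((ρ V e : ℂ) • suProj (plaquetteLoopSum V e.1 e.2)),
              exp_smul_suProj_mem (ρ V e) (plaquetteLoopSum V e.1 e.2)⟩ :
            Matrix.specialUnitaryGroup (Fin n) ℂ) * V e
        else V e)
      (fun U => ENNReal.ofReal (∏ a : {e : Edge d L // p e}, (TopS[(1 : ℝ), coeConfig U, a.1]).det)) := by
  rw [sunStoutLayer_eq_coupleFun p ρ R hR h1 h2 h3 h4 h5 h6]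
  -- the staple sum read off the frozen links, and the fibre exponent (as in `hasJacobian_sunStoutLatticeLayer`)
  set S : {e : Edge d L // p e} → ({f : Edge d L // ¬p f} → Matrix.specialUnitaryGroup (Fin n) ℂ) →
      Matrix (Fin n) (Fin n) ℂ := fun a y =>
    ∑ ν : Fin d, if hν : ν = a.1.2 then (0 : Matrix (Fin n) (Fin n) ℂ) else
      (((y ⟨_, h1 a.1 a.2 ν hν⟩ * (y ⟨_, h2 a.1 a.2 ν hν⟩)⁻¹ * (y ⟨_, h3 a.1 a.2 ν hν⟩)⁻¹ :
          Matrix.specialUnitaryGroup (Fin n) ℂ) : Matrix (Fin n) (Fin n) ℂ) +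
        (((y ⟨_, h4 a.1 a.2 ν hν⟩)⁻¹ * (y ⟨_, h5 a.1 a.2 ν hν⟩)⁻¹ * y ⟨_, h6 a.1 a.2 ν hν⟩ :
          Matrix.specialUnitaryGroup (Fin n) ℂ) : Matrix (Fin n) (Fin n) ℂ)) with hS
  set Q : {e : Edge d L // p e} → ({f : Edge d L // ¬p f} → Matrix.specialUnitaryGroup (Fin n) ℂ) →
      Matrix (Fin n) (Fin n) ℂ → Matrix (Fin n) (Fin n) ℂ := fun a y u => (R a.1 y : ℂ) • suProj (u * S a y) with hQ
  have hQsk : ∀ a y, ∀ U ∈ Matrix.specialUnitaryGroup (Fin n) ℂ, (Q a y U)ᴴ = -Q a y U ∧ (Q a y U).trace = 0 :=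
    fun a y U _ => smul_suProj_skew (R a.1 y) _
  have hfib : (fun a y (u : Matrix.specialUnitaryGroup (Fin n) ℂ) =>
      (⟨NormedSpace.exp ((R a.1 y : ℂ) • suProj ((u : Matrix (Fin n) (Fin n) ℂ) *
          ∑ ν : Fin d, if hν : ν = a.1.2 then (0 : Matrix (Fin n) (Fin n) ℂ) else
            (((y ⟨_, h1 a.1 a.2 ν hν⟩ * (y ⟨_, h2 a.1 a.2 ν hν⟩)⁻¹ * (y ⟨_, h3 a.1 a.2 ν hν⟩)⁻¹ :
                Matrix.specialUnitaryGroup (Fin n) ℂ) : Matrix (Fin n) (Fin n) ℂ) +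
              (((y ⟨_, h4 a.1 a.2 ν hν⟩)⁻¹ * (y ⟨_, h5 a.1 a.2 ν hν⟩)⁻¹ * y ⟨_, h6 a.1 a.2 ν hν⟩ :
                Matrix.specialUnitaryGroup (Fin n) ℂ) : Matrix (Fin n) (Fin n) ℂ)))),
        exp_smul_suProj_mem _ _⟩ : Matrix.specialUnitaryGroup (Fin n) ℂ) * u) =
      fun a y (u : Matrix.specialUnitaryGroup (Fin n) ℂ) =>
        (⟨NormedSpace.exp (Q a y u) * u, residual_value_mem (hQsk a y) u.2⟩ :
          Matrix.specialUnitaryGroup (Fin n) ℂ) := by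
    funext a y u
    exact Subtype.ext rfl
  rw [hfib]
  have hlip : ∀ a y, ∀ U ∈ Matrix.specialUnitaryGroup (Fin n) ℂ, ∀ V ∈ Matrix.specialUnitaryGroup (Fin n) ℂ,
      frobNorm (Q a y U - Q a y V) ≤ (2 * (d - 1 : ℝ) * |R a.1 y|) * frobNorm (U - V) := by
    intro a y U _ V _
    exact frobNorm_stoutFibreExponent_sub_le (R a.1 y) a.1.2
      (fun ν hν => (y ⟨_, h1 a.1 a.2 ν hν⟩ * (y ⟨_, h2 a.1 a.2 ν hν⟩)⁻¹ * (y ⟨_, h3 a.1 a.2 ν hν⟩)⁻¹).2.1)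
      (fun ν hν => ((y ⟨_, h4 a.1 a.2 ν hν⟩)⁻¹ * (y ⟨_, h5 a.1 a.2 ν hν⟩)⁻¹ * y ⟨_, h6 a.1 a.2 ν hν⟩).2.1) U V
  have hκ0 : ∀ (a : {e : Edge d L // p e}) (y : {f : Edge d L // ¬p f} → Matrix.specialUnitaryGroup (Fin n) ℂ),
      0 ≤ 2 * (d - 1 : ℝ) * |R a.1 y| := by
    intro a y
    have hd : (1 : ℝ) ≤ d := by exact_mod_cast Fin.pos a.1.2
    exact mul_nonneg (by linarith) (abs_nonneg _)
  -- the ambient realisation `ρ · 𝒫(loopSumAmb)` — written so that `Top` of the residual series IS `TopS`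
  have hQ2 : ∀ a : {e : Edge d L // p e}, ContDiff ℝ 2
      ((fun (a : {e : Edge d L // p e}) (W : AmbConfig d L n) =>
        (Ramb a.1 W : ℂ) • suProj (loopSumAmb W a.1.1 a.1.2)) a) := fun a =>
    (Complex.ofRealCLM.contDiff.comp (hRamb2 a.1)).smul (contDiff_suProj.comp (contDiff_loopSumAmb a.1.1 a.1.2))
  have hQambQ : ∀ a (U : GaugeConfig d L (Matrix.specialUnitaryGroup (Fin n) ℂ)),
      (fun (a : {e : Edge d L // p e}) (W : AmbConfig d L n) =>
        (Ramb a.1 W : ℂ) • suProj (loopSumAmb W a.1.1 a.1.2)) a (coeConfig U) =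
        Q a (fun f => U f) (U a.1 : Matrix (Fin n) (Fin n) ℂ) := by
    intro a U
    simp only [hQ, hS]
    rw [hRambR U a.1 a.2, loopSumAmb_coeConfig, plaquetteLoopSum_eq_link_mul]
    rfl
  exact hasJacobian_sunResidualLayer_det p Q (fun a y => 2 * (d - 1 : ℝ) * |R a.1 y|)
    (fun (a : {e : Edge d L // p e}) (W : AmbConfig d L n) => (Ramb a.1 W : ℂ) • suProj (loopSumAmb W a.1.1 a.1.2))
    hQsk hlip hκ0 (fun a y => hκ a.1 y a.2) hQ2 hQambQ

/-- **The classic stout step** (one constant parameter `r`, `2(d−1)|r| < 1`, mask with frozen staples `h1`–`h6`,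
e.g. the engine's generalized-checkerboard direction masks): its exact Jacobian for product Haar is the closed
form `∏_{a active} det TopS[1, U, a]` with the constant coefficient. -/
theorem hasJacobian_sunStoutLatticeLayer_const_det (r : ℝ)
    (h1 : ∀ e, p e → ∀ ν, ν ≠ e.2 → ¬p (e.1.shift e.2, ν))
    (h2 : ∀ e, p e → ∀ ν, ν ≠ e.2 → ¬p (e.1.shift ν, e.2))
    (h3 : ∀ e, p e → ∀ ν, ν ≠ e.2 → ¬p (e.1, ν))
    (h4 : ∀ e, p e → ∀ ν, ν ≠ e.2 → ¬p ((e.1 - Pi.single ν 1).shift e.2, ν))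
    (h5 : ∀ e, p e → ∀ ν, ν ≠ e.2 → ¬p (e.1 - Pi.single ν 1, e.2))
    (h6 : ∀ e, p e → ∀ ν, ν ≠ e.2 → ¬p (e.1 - Pi.single ν 1, ν))
    (hr : 2 * (d - 1 : ℝ) * |r| < 1) (hRamb : Ramb = fun _ _ => r) :
    Continuous (fun U : GaugeConfig d L (Matrix.specialUnitaryGroup (Fin n) ℂ) =>
      ∏ a : {e : Edge d L // p e}, (TopS[(1 : ℝ), coeConfig U, a.1]).det) ∧
    (∀ U : GaugeConfig d L (Matrix.specialUnitaryGroup (Fin n) ℂ),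
      0 < ∏ a : {e : Edge d L // p e}, (TopS[(1 : ℝ), coeConfig U, a.1]).det) ∧
    HasJacobian (Measure.pi fun _ : Edge d L => haarProbability (Matrix.specialUnitaryGroup (Fin n) ℂ))
      (fun (V : GaugeConfig d L (Matrix.specialUnitaryGroup (Fin n) ℂ)) (e : Edge d L) =>
        if p e then
          (⟨NormedSpace.exp ((r : ℂ) • suProj (plaquetteLoopSum V e.1 e.2)),
              exp_smul_suProj_mem r (plaquetteLoopSum V e.1 e.2)⟩ :
            Matrix.specialUnitaryGroup (Fin n) ℂ) * V e
        else V e)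
      (fun U => ENNReal.ofReal (∏ a : {e : Edge d L // p e}, (TopS[(1 : ℝ), coeConfig U, a.1]).det)) :=
  hasJacobian_sunStoutLatticeLayer_det p Ramb (fun _ _ => r) (fun _ _ => r) (fun _ _ _ => rfl)
    h1 h2 h3 h4 h5 h6 (fun _ _ _ => hr) (fun e => by rw [hRamb]; exact contDiff_const)
    (fun V e _ => by rw [hRamb])

end Stout

end Summit.Ventures.LatticeQCDFlow.Exactness

end
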